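import Summits.QuantumFields.YangMills.Theorems.UnitScaleTiltProp7FlatSliceRegularity
import Summits.QuantumFields.YangMills.Theorems.UnitScaleTiltProp7CovariantActionHS
import HarnessLib

/-!
# Route `UnitScaleTilt`, crux K1 child «MinimiserStabilityRegPr» (stmt-QuantumFields-19200), registered stub `stub_prop7From14` (V3, skeleton v7
# cc37a1787726) — lane B: **SUMMATION BY PARTS FOR THE CURL AND THE CURL–CURL OPERATOR POINTWISE** — the junction between the flat slice
# regularity (V1 letters `dcsE (dcE ·)` of `B6SectAOperatorsV1`, files `Prop7FlatSliceRegularity(T3)`) and the flat linearisation of the current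
# (torus letters, file `Prop7FlatCurrentLinearisation`): `(∂*∂y)(b) = c²·Σ_ν [C_y(b₋ − e_ν; ν, μ_b) − C_y(b₋; ν, μ_b)]`,
# `C_y(z; κ, μ) = y(z,κ) + y(z+e_κ,μ) − y(z+e_μ,κ) − y(z,μ)`

Cell `ym3-torus` ∕ fleet seat `ym-ust-19200-p3` (WIDTH-LEVER lane B of V3; HUMAN RULING D-0037, YM ladder rung R3).  `--supports stmt-QuantumFields-19200
--as helper`.  Elementary lattice calculus on the Setup torus `Site P j` (any `Params`, any level); nothing of Bałaban's analysis; NOT a claim about the mass gap.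

WHY.  The lane-B regularity estimate (`Prop7FlatSliceRegularity.abs_le_of_critical_of_letters`, `…T3.abs_le_of_critical_T3`) bounds a slice field by
the remainder `r` in `∂*∂A + r ⊥ ker Q`, where `∂*∂ = dcsE c ∘ dcE c` is defined through the `ℓ²`-ADJOINT (`LinearMap.adjoint`) and has no pointwise
formula in the tree; the current linearisation (`Prop7FlatCurrentLinearisation.norm_div2_curl_sub_covDivT_le`) produces the EXPLICIT flat operator
`Σ_ν [C(x − e_ν; ν, μ) − C(x; ν, μ)]`.  This file proves they are the same operator (times `c²`, componentwise), by summation by parts on the torus: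
`Σ_p (∂x)(p)(∂y)(p) = Σ_b x(b)(∂*∂y)(b)` with the explicit right-hand side (lane A's `Prop7CovariantCoercivity.sum_plaq_eq_sum_ite` turns the plaquette
sum into a restricted triple sum; the summand is symmetric with zero diagonal, so it is half the full sum; `C_x = D_μx_ν − D_νx_μ` and the antisymmetry of
`C_y` reduce to `Σ D_μx_ν·C_y`; `LatticeFieldCalculus.sum_pdiff_mul` moves the difference).
* §1 `sum_ite_lt_eq_half_sum`, `sum_bond_eq_sum_site_dir` (bookkeeping).
* §2 **`sum_curl_mul_curl_eq`** — `Σ_p curl c x p · curl c y p = Σ_b x b · (c²·Σ_ν [C_y(b₋−e_ν;ν,μ_b) − C_y(b₋;ν,μ_b)])` for real bond fields (`LatticeFieldCalculus.curl`,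
  plaquettes `Plaq P j`, `μ < ν`).
* §3 **`inner_dcE_dcE_eq_sum`**, **`dcsE_dcE_apply`** — the V1 letters: `⟪∂x, ∂y⟫` and `(dcsE c (dcE c y))(b)` pointwise, in exactly the shift-form of
  `Prop7FlatCurrentLinearisation` §3 (`(b₋.unshift ν).shift ν` left unsimplified to match).
No definition, no sorry, standard axioms.

References: T. Bałaban, CMP **95** (1984) 17–40 [Balaban1984PropagatorsI] ((1.2)–(1.3) p.18, (1.21) p.21); CMP **96** (1984) 223–250 [Balaban1984PropagatorsII]
((2.5) p.224, (2.19) p.226).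
-/

set_option autoImplicit false

noncomputable section

open scoped BigOperators InnerProductSpace

namespace Summit.QuantumFields.YangMills.Theorems.Prop7FlatCurlCurl

open Finset
open Literature.MathematicalPhysics.QuantumFieldTheory.Balaban1983to89
open Literature.MathematicalPhysics.QuantumFieldTheory.BalabanImbrieJaffe1984to88.BIJ85AxialPropagator411 (BondSpace PlaqSpace)
open LatticeFieldCalculus B6SectAOperatorsV1
open Summit.QuantumFields.YangMills.Theorems.Prop7CovariantCoercivity (sum_plaq_eq_sum_ite)

variable {P : Params} {j : ℕ}

/-! ## §1 Two finite-sum lemmas -/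

/-- For a symmetric matrix of reals with zero diagonal, the sum over `μ < ν` is half the full sum. [folklore] -/
theorem sum_ite_lt_eq_half_sum {d : ℕ} (G : Fin d → Fin d → ℝ) (hsymm : ∀ μ ν, G μ ν = G ν μ) (hdiag : ∀ μ, G μ μ = 0) :
    ∑ μ : Fin d, ∑ ν : Fin d, (if μ < ν then G μ ν else 0) = (1 / 2) * ∑ μ : Fin d, ∑ ν : Fin d, G μ ν := by
  have hsplit : ∀ μ ν : Fin d, G μ ν = (if μ < ν then G μ ν else 0) + (if ν < μ then G μ ν else 0) := by
    intro μ ν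
    rcases lt_trichotomy μ ν with h | h | h
    · rw [if_pos h, if_neg (not_lt.2 h.le), add_zero]
    · subst h; simp only [lt_irrefl, if_false, add_zero, hdiag]
    · rw [if_neg (not_lt.2 h.le), if_pos h, zero_add]
  have hswap : ∑ μ : Fin d, ∑ ν : Fin d, (if ν < μ then G μ ν else 0) = ∑ μ : Fin d, ∑ ν : Fin d, (if μ < ν then G μ ν else 0) := by
    rw [Finset.sum_comm]
    exact Finset.sum_congr rfl fun μ _ => Finset.sum_congr rfl fun ν _ => by rw [hsymm]
  have htot : ∑ μ : Fin d, ∑ ν : Fin d, G μ ν = 2 * ∑ μ : Fin d, ∑ ν : Fin d, (if μ < ν then G μ ν else 0) := by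
    calc ∑ μ : Fin d, ∑ ν : Fin d, G μ ν
        = ∑ μ : Fin d, ∑ ν : Fin d, ((if μ < ν then G μ ν else 0) + (if ν < μ then G μ ν else 0)) :=
          Finset.sum_congr rfl fun μ _ => Finset.sum_congr rfl fun ν _ => hsplit μ ν
      _ = ∑ μ : Fin d, ∑ ν : Fin d, (if μ < ν then G μ ν else 0) + ∑ μ : Fin d, ∑ ν : Fin d, (if ν < μ then G μ ν else 0) := by
          simp only [Finset.sum_add_distrib]
      _ = 2 * ∑ μ : Fin d, ∑ ν : Fin d, (if μ < ν then G μ ν else 0) := by rw [hswap]; ring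
  rw [htot]; ring

/-- A sum over bonds is a double sum over sites and directions (`LatticeFieldCalculus.bondEquiv`). [folklore] -/
theorem sum_bond_eq_sum_site_dir {α : Type*} [AddCommMonoid α] (F : PBond P j → α) :
    ∑ b : PBond P j, F b = ∑ x : Site P j, ∑ μ : Fin P.d, F ⟨x, μ⟩ :=
  calc ∑ b : PBond P j, F b = ∑ p : Site P j × Fin P.d, F (bondEquiv p) := (Equiv.sum_comp (LatticeFieldCalculus.bondEquiv (P := P) (j := j)) F).symm
    _ = ∑ x : Site P j, ∑ μ : Fin P.d, F ⟨x, μ⟩ := Fintype.sum_prod_type _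

/-! ## §2 Summation by parts for the curl: `Σ_p (∂A)(p)(∂B)(p) = Σ_b A(b)·(∂*∂B)(b)` with `∂*∂` the explicit flat second-order operator -/

/-- **`Σ_p curl A(p)·curl B(p) = Σ_b A(b)·(c²·Σ_ν [C_B(b₋ − e_ν; ν, μ_b) − C_B(b₋; ν, μ_b)])`**, `C_B(z; κ, μ) = B(z,κ) + B(z+e_κ,μ) − B(z+e_μ,κ) − B(z,μ)` —
summation by parts for the plaquette variable on the torus: the adjoint-composite `∂*∂` is `c²` times the flat operator `div₂(curl ·)` of
`Prop7FlatCurrentLinearisation` (every ordered pair `(ν, μ)`, the pair `ν = μ` contributing zero). [cite: Balaban1984PropagatorsI, (1.21) p.21, (1.2)-(1.3) p.18] -/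
theorem sum_curl_mul_curl_eq (c : ℝ) (x y : VecField P j ℝ) :
    ∑ p : Plaq P j, curl c x p * curl c y p
      = ∑ b : PBond P j, x b * (c ^ 2 * ∑ ν : Fin P.d,
          ((y ⟨b.src.unshift ν, ν⟩ + y ⟨(b.src.unshift ν).shift ν, b.dir⟩ - y ⟨(b.src.unshift ν).shift b.dir, ν⟩ - y ⟨b.src.unshift ν, b.dir⟩)
            - (y ⟨b.src, ν⟩ + y ⟨b.src.shift ν, b.dir⟩ - y ⟨b.src.shift b.dir, ν⟩ - y ⟨b.src, b.dir⟩))) := by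
  -- the curl brackets as functions of (site, first direction, second direction)
  set Cx : Site P j → Fin P.d → Fin P.d → ℝ := fun s μ ν => x ⟨s, μ⟩ + x ⟨s.shift μ, ν⟩ - x ⟨s.shift ν, μ⟩ - x ⟨s, ν⟩ with hCx
  set Cy : Site P j → Fin P.d → Fin P.d → ℝ := fun s μ ν => y ⟨s, μ⟩ + y ⟨s.shift μ, ν⟩ - y ⟨s.shift ν, μ⟩ - y ⟨s, ν⟩ with hCy
  have hCx_anti : ∀ s μ ν, Cx s ν μ = -Cx s μ ν := fun s μ ν => by simp only [hCx]; ring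
  have hCy_anti : ∀ s μ ν, Cy s ν μ = -Cy s μ ν := fun s μ ν => by simp only [hCy]; ring
  -- Step 1: the plaquette sum as a restricted triple sum
  have h1 : ∑ p : Plaq P j, curl c x p * curl c y p = ∑ s : Site P j, ∑ μ : Fin P.d, ∑ ν : Fin P.d,
      (if μ < ν then c ^ 2 * (Cx s μ ν * Cy s μ ν) else 0) := by
    have h := sum_plaq_eq_sum_ite (P := P) (j := j) (fun s μ ν => c ^ 2 * (Cx s μ ν * Cy s μ ν))
    rw [← h]
    refine Finset.sum_congr rfl fun p _ => ?_
    simp only [curl, smul_eq_mul, hCx, hCy]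
    ring
  -- Step 2: half of the full triple sum (the summand is symmetric in `(μ, ν)` with zero diagonal)
  have h2 : ∀ s : Site P j, ∑ μ : Fin P.d, ∑ ν : Fin P.d, (if μ < ν then c ^ 2 * (Cx s μ ν * Cy s μ ν) else 0)
      = (1 / 2) * ∑ μ : Fin P.d, ∑ ν : Fin P.d, c ^ 2 * (Cx s μ ν * Cy s μ ν) := by
    intro s
    refine sum_ite_lt_eq_half_sum (fun μ ν => c ^ 2 * (Cx s μ ν * Cy s μ ν)) (fun μ ν => ?_) (fun μ => ?_)
    · rw [hCx_anti s μ ν, hCy_anti s μ ν]; ring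
    · have : Cx s μ μ = 0 := by simp only [hCx]; ring
      rw [this]; ring
  -- Step 3: `Cx = D_μ x_ν − D_ν x_μ`; by antisymmetry of `Cy` the two halves agree
  have h3 : ∀ s : Site P j, (1 / 2 : ℝ) * ∑ μ : Fin P.d, ∑ ν : Fin P.d, c ^ 2 * (Cx s μ ν * Cy s μ ν)
      = ∑ μ : Fin P.d, ∑ ν : Fin P.d, c ^ 2 * ((x ⟨s.shift μ, ν⟩ - x ⟨s, ν⟩) * Cy s μ ν) := by
    intro s
    have hsplitx : ∀ μ ν, Cx s μ ν = (x ⟨s.shift μ, ν⟩ - x ⟨s, ν⟩) - (x ⟨s.shift ν, μ⟩ - x ⟨s, μ⟩) := fun μ ν => by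
      simp only [hCx]; ring
    have hA : ∑ μ : Fin P.d, ∑ ν : Fin P.d, c ^ 2 * (Cx s μ ν * Cy s μ ν)
        = ∑ μ : Fin P.d, ∑ ν : Fin P.d, c ^ 2 * ((x ⟨s.shift μ, ν⟩ - x ⟨s, ν⟩) * Cy s μ ν)
          - ∑ μ : Fin P.d, ∑ ν : Fin P.d, c ^ 2 * ((x ⟨s.shift ν, μ⟩ - x ⟨s, μ⟩) * Cy s μ ν) := by
      rw [← Finset.sum_sub_distrib]
      refine Finset.sum_congr rfl fun μ _ => ?_
      rw [← Finset.sum_sub_distrib]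
      exact Finset.sum_congr rfl fun ν _ => by rw [hsplitx]; ring
    have hB : ∑ μ : Fin P.d, ∑ ν : Fin P.d, c ^ 2 * ((x ⟨s.shift ν, μ⟩ - x ⟨s, μ⟩) * Cy s μ ν)
        = -∑ μ : Fin P.d, ∑ ν : Fin P.d, c ^ 2 * ((x ⟨s.shift μ, ν⟩ - x ⟨s, ν⟩) * Cy s μ ν) := by
      rw [Finset.sum_comm, ← Finset.sum_neg_distrib]
      refine Finset.sum_congr rfl fun μ _ => ?_
      rw [← Finset.sum_neg_distrib]
      exact Finset.sum_congr rfl fun ν _ => by rw [hCy_anti s μ ν]; ring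
    rw [hA, hB]; ring
  -- Step 4: summation by parts in the direction `μ`, for each `(μ, ν)`
  have h4 : ∀ μ ν : Fin P.d, ∑ s : Site P j, c ^ 2 * ((x ⟨s.shift μ, ν⟩ - x ⟨s, ν⟩) * Cy s μ ν)
      = ∑ s : Site P j, x ⟨s, ν⟩ * (c ^ 2 * (Cy (s.unshift μ) μ ν - Cy s μ ν)) := by
    intro μ ν
    have h := sum_pdiff_mul (P := P) (j := j) 1 μ (fun z => x ⟨z, ν⟩) (fun z => Cy z μ ν)
    simp only [pdiff, pdiffAdj, one_smul] at h
    calc ∑ s : Site P j, c ^ 2 * ((x ⟨s.shift μ, ν⟩ - x ⟨s, ν⟩) * Cy s μ ν)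
        = c ^ 2 * ∑ s : Site P j, (x ⟨s.shift μ, ν⟩ - x ⟨s, ν⟩) * Cy s μ ν := by rw [Finset.mul_sum]
      _ = c ^ 2 * ∑ s : Site P j, x ⟨s, ν⟩ * (Cy (s.unshift μ) μ ν - Cy s μ ν) := by rw [h]
      _ = ∑ s : Site P j, x ⟨s, ν⟩ * (c ^ 2 * (Cy (s.unshift μ) μ ν - Cy s μ ν)) := by
          rw [Finset.mul_sum]; exact Finset.sum_congr rfl fun s _ => by ring
  -- Step 5: reassemble
  calc ∑ p : Plaq P j, curl c x p * curl c y p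
      = ∑ s : Site P j, ∑ μ : Fin P.d, ∑ ν : Fin P.d, c ^ 2 * ((x ⟨s.shift μ, ν⟩ - x ⟨s, ν⟩) * Cy s μ ν) := by
        rw [h1]; exact Finset.sum_congr rfl fun s _ => by rw [h2, h3]
    _ = ∑ μ : Fin P.d, ∑ ν : Fin P.d, ∑ s : Site P j, c ^ 2 * ((x ⟨s.shift μ, ν⟩ - x ⟨s, ν⟩) * Cy s μ ν) := by
        rw [Finset.sum_comm]
        exact Finset.sum_congr rfl fun μ _ => Finset.sum_comm (s := (Finset.univ : Finset (Site P j)))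
          (t := (Finset.univ : Finset (Fin P.d)))
    _ = ∑ μ : Fin P.d, ∑ ν : Fin P.d, ∑ s : Site P j, x ⟨s, ν⟩ * (c ^ 2 * (Cy (s.unshift μ) μ ν - Cy s μ ν)) :=
        Finset.sum_congr rfl fun μ _ => Finset.sum_congr rfl fun ν _ => h4 μ ν
    _ = ∑ μ : Fin P.d, ∑ s : Site P j, ∑ ν : Fin P.d, x ⟨s, ν⟩ * (c ^ 2 * (Cy (s.unshift μ) μ ν - Cy s μ ν)) :=
        Finset.sum_congr rfl fun μ _ => Finset.sum_comm
    _ = ∑ s : Site P j, ∑ μ : Fin P.d, ∑ ν : Fin P.d, x ⟨s, ν⟩ * (c ^ 2 * (Cy (s.unshift μ) μ ν - Cy s μ ν)) :=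
        Finset.sum_comm
    _ = ∑ s : Site P j, ∑ ν : Fin P.d, ∑ μ : Fin P.d, x ⟨s, ν⟩ * (c ^ 2 * (Cy (s.unshift μ) μ ν - Cy s μ ν)) :=
        Finset.sum_congr rfl fun s _ => Finset.sum_comm
    _ = ∑ s : Site P j, ∑ ν : Fin P.d, x ⟨s, ν⟩ * (c ^ 2 * ∑ μ : Fin P.d, (Cy (s.unshift μ) μ ν - Cy s μ ν)) := by
        refine Finset.sum_congr rfl fun s _ => Finset.sum_congr rfl fun ν _ => ?_
        rw [Finset.mul_sum, Finset.mul_sum]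
    _ = _ := by
        rw [sum_bond_eq_sum_site_dir]

/-! ## §3 The V1 letters: `⟪∂x, ∂y⟫` and the curl–curl operator `dcsE c ∘ dcE c` pointwise -/

/-- **`⟪∂x, ∂y⟫ = Σ_b x(b)·(∂*∂y)(b)`** with the explicit flat operator (V1 letters `dcE` of `B6SectAOperatorsV1`).
[cite: Balaban1984PropagatorsII, (2.5) p.224, (2.19) p.226] -/
theorem inner_dcE_dcE_eq_sum (c : ℝ) (x y : BondSpace P) :
    ⟪dcE c x, dcE c y⟫_ℝ = ∑ b : PBond P 0, x b * (c ^ 2 * ∑ ν : Fin P.d,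
        ((y ⟨b.src.unshift ν, ν⟩ + y ⟨(b.src.unshift ν).shift ν, b.dir⟩ - y ⟨(b.src.unshift ν).shift b.dir, ν⟩ - y ⟨b.src.unshift ν, b.dir⟩)
          - (y ⟨b.src, ν⟩ + y ⟨b.src.shift ν, b.dir⟩ - y ⟨b.src.shift b.dir, ν⟩ - y ⟨b.src, b.dir⟩))) := by
  rw [Prop7FlatSliceRegularity.inner_dcE_dcE]
  exact sum_curl_mul_curl_eq c (WithLp.ofLp x) (WithLp.ofLp y)

/-- **THE CURL–CURL OPERATOR `∂*∂` OF THE V1 MODEL, POINTWISE**: `(∂*∂y)(b) = c²·Σ_ν [C_y(b₋ − e_ν; ν, μ_b) − C_y(b₋; ν, μ_b)]` — the adjoint-composite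
`dcsE c (dcE c ·)` of `B6SectAOperatorsV1` (the first term of `Δ_a` (2.19), the linearised current of `Prop7FlatSliceRegularity`) IS `c²` times the flat
operator `div₂(curl ·)` of `Prop7FlatCurrentLinearisation` read componentwise — the junction between the flat slice regularity (V1 letters) and the
flat linearisation of the current (torus letters). [cite: Balaban1984PropagatorsII, (2.19) p.226; Balaban1984PropagatorsI, (1.21) p.21] -/
theorem dcsE_dcE_apply (c : ℝ) (y : BondSpace P) (b : PBond P 0) :
    dcsE c (dcE c y) b = c ^ 2 * ∑ ν : Fin P.d,
        ((y ⟨b.src.unshift ν, ν⟩ + y ⟨(b.src.unshift ν).shift ν, b.dir⟩ - y ⟨(b.src.unshift ν).shift b.dir, ν⟩ - y ⟨b.src.unshift ν, b.dir⟩)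
          - (y ⟨b.src, ν⟩ + y ⟨b.src.shift ν, b.dir⟩ - y ⟨b.src.shift b.dir, ν⟩ - y ⟨b.src, b.dir⟩)) := by
  classical
  have h1 : dcsE c (dcE c y) b = ⟪EuclideanSpace.single b (1 : ℝ), dcsE c (dcE c y)⟫_ℝ := by
    rw [EuclideanSpace.inner_single_left]; simp
  rw [h1, real_inner_comm, inner_dcsE_left, real_inner_comm, inner_dcE_dcE_eq_sum]
  rw [Finset.sum_eq_single b]
  · rw [PiLp.single_apply, if_pos rfl, one_mul]
  · intro b' _ hb'
    rw [PiLp.single_apply, if_neg hb', zero_mul]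
  · intro h; exact absurd (Finset.mem_univ b) h

end Summit.QuantumFields.YangMills.Theorems.Prop7FlatCurlCurl

end
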